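import Literature.Geometry.Kaehler.ComplexTorusIntegralHodgeLatticeThetaDegreesFourierDuality
import HarnessLib

/-!
# The Fourier transform exchanges the minimal classes of `(X, L)` and `(X̂, L_δ)`: `F(γ_k) = (−1)^k·γ̂_{g−k}`,
# `⟨γ̂_{g−k}, F z⟩^X̂ = (−1)^{g−k}·⟨γ_k, z⟩^X`, and the value group of a minimal class on the integral Hodge lattice is Fourier-invariant

Layer `Literature/Geometry/Kaehler`, namespace `Literature.Geometry.Kaehler.ComplexTorus`; lane `lit-hodgefound`
(Track 2 foundations library), seat p09, generation 50, row g50-#2. THEOREMS ONLY (0 definitions); no named fact, net debt 0.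
Sequel of g50-#1 `ComplexTorusIntegralHodgeLatticeThetaDegreesFourierDuality` (`k!·F(θ^{∧l}) = (−1)^l·l!·(d₁⋯d_g)·(E^*)^{∧k}`, Parseval transport
of `θ`-degrees), of g36-#1 `ComplexTorusMinimalClasses` (the MINIMAL CLASS `γ_k`: `θ^{∧k} = (k!·d₁⋯d_k)·γ_k` with `γ_k ∈ Hdgᵏ(X, ℤ)` primitive,
Lange Thm. 2.5.16 / Benoist–Debarre §1) and of `ComplexTorusDualPolarizationType` (the dual polarisation `E_δ = d₁d_g·E^*` of `X̂`, of type
`δ̂ = (d₁d_g/d_g, d₁d_g/d_{g−1}, …, d₁d_g/d₁)`, Lange Prop. 2.5.1).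

THE POINT. Beauville's formula (Lange Thm. 6.3.5 / (6.12): `F(c₁(L)^{∧k}/k!) = d·(E^*)^{∧(g−k)}/(g−k)!`, the tree's
`IsPolarizationType.fourierForm_wedgePow_chernClass_div_factorial`) says that the cohomological Fourier transform `F : H^{2k}(X) → H^{2g−2k}(X̂)`
maps the divided power `θ^{∧k}/k!` to `±d·(E^*)^{∧(g−k)}/(g−k)!`. Reading both sides through the CONTENTS of the two polarisations —
`θ^{∧k} = C_k·γ_k`, `C_k = k!·d₁⋯d_k`, and `θ̂^{∧l} = Ĉ_l·γ̂_l`, `θ̂ = E_δ = d₁d_g·E^*`, `Ĉ_l = l!·δ̂₁⋯δ̂_l = l!·(d₁d_g)^l/(d_{k+1}⋯d_g)` (`k + l = g`) —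
and using the arithmetic identity of types **`k!·(d₁⋯d_g)·Ĉ_l = l!·C_k·(d₁d_g)^l`** (§1), the rational factor is EXACTLY `±1`:

* §2 **`F(γ_k) = (−1)^k·γ̂_l`** (`IsPolarizationType.fourierForm_minimalClass`): THE FOURIER TRANSFORM CARRIES THE MINIMAL CLASS OF CODIMENSION `k`
  OF `(X, L)` TO `(−1)^k` TIMES THE MINIMAL CLASS OF CODIMENSION `g − k` OF THE DUAL POLARISED TORUS `(X̂, L_δ)` — for every type, every
  presentation, every enumeration (as it must: `F` is an integral isomorphism, so it maps the primitive vector `γ_k` of the line `ℚθ^{∧k}` to a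
  primitive vector of the line `ℚθ̂^{∧l} = F(ℚθ^{∧k})`); principal case: `F(θ^{∧k}/k!) = (−1)^k·θ̂^{∧l}/l!` (Beauville, Mukai). Data-free form with
  `γ_k ∈ Hdgᵏ(X, ℤ)`, `γ̂_l ∈ Hdg^l(X̂, ℤ)`: `IsPolarizationType.exists_fourierForm_minimalClass`.
* §3 **`⟨γ̂_l, F z⟩^X̂_e = (−1)^l·⟨γ_k, z⟩^X_e`** for every `z ∈ H^{2l}(X, ℂ)` (`IsPolarizationType.poincarePairing_dualMinimalClass_fourierForm`; Parseval
  `⟨F x, F y⟩^X̂ = (−1)^g⟨x, y⟩^X`): the pairing with the minimal classes is Fourier-invariant up to sign. Hence (`F : Hdg^l(X, ℤ) ⥲ Hdgᵏ(X̂, ℤ)`,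
  Prop. 6.2.20/6.2.21) **the value groups `⟨γ_k, Hdg^l(X, ℤ)⟩` and `⟨γ̂_l, Hdgᵏ(X̂, ℤ)⟩` are the same subgroup of `ℤ`**: a positive `ε`
  divides all values and is attained on one side iff on the other (`IsPolarizationType.minimalClass_valueGenerator_iff_dual`), and
  **`⟨γ_k, z⟩ = 0 ⟺ ⟨γ̂_l, F z⟩ = 0`** (`IsPolarizationType.poincarePairing_minimalClass_eq_zero_iff_fourier`): `F` maps the `γ_k`-orthogonal
  integral Hodge classes of `X` onto the `γ̂_l`-orthogonal integral Hodge classes of `X̂`. With `δ_l(X) = C_k·ε` and `δ̂_k(X̂) = Ĉ_l·ε` (g49-#11's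
  `θ`-degree generators) this is g50-#1's `δ_l(X)·l!·(d₁d_g)^l = δ̂_k(X̂)·k!·d₁⋯d_g` read through §1.

What is formalised is OUR ROAD (the printed sources give Thm. 6.3.5 / (6.12), Prop. 6.2.20–6.2.21 and Prop. 2.5.1; the minimal-class bookkeeping
for an arbitrary type is not printed there).

## Contents (theorems only; no definition, no named fact)

* §1 `IsPolarizationType.prod_rev_castLE_eq_prod_natAdd`, `IsPolarizationType.prod_dualType_castLE_mul_prod_eq_pow`,
  **`IsPolarizationType.factorial_mul_prod_mul_dualContent_eq`** (`k!·(d₁⋯d_g)·Ĉ_l = l!·C_k·(d₁d_g)^l`).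
* §2 **`IsPolarizationType.fourierForm_minimalClass`**, `IsPolarizationType.exists_fourierForm_minimalClass`.
* §3 **`IsPolarizationType.poincarePairing_dualMinimalClass_fourierForm`**, `IsPolarizationType.poincarePairing_minimalClass_eq_zero_iff_fourier`,
  `IsPolarizationType.minimalClass_valueGenerator_dual`, **`IsPolarizationType.minimalClass_valueGenerator_iff_dual`**.

## References

* [cite: Lange2023AbelianVarietiesComplex, §6.3.2 Thm. 6.3.5 with (6.12) (pp. 315–316); §6.2.4 Prop. 6.2.20, Prop. 6.2.21 (pp. 310–311); §2.5.1 Prop. 2.5.1 (p. 131); §2.5.3 Thm. 2.5.16, Cor. 2.5.17 (PDF p. 135); §4.2 Poincaré's formula (PDF p. 204)]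
* [cite: Beauville1983FourierChow, §3 Prop. 5 (p. 248)]
* [cite: Mukai1981, §2 Thm. 2.2 (pp. 155–157)]
* [cite: BenoistDebarre2023SmoothSubvarietiesJacobians, §1 (p. 3); §3 proof of Thm. 3.7 (p. 7)]
-/

noncomputable section

-- `Module ℂ` / `SMulZeroClass ℂ` synthesis on `E [⋀^Fin k]→L[ℝ] ℂ` (as in `ComplexTorusLefschetzDecomposition`)
set_option maxSynthPendingDepth 3

open Module Function Complex
open LinearMap (BilinForm)
open Literature.LinearAlgebra.Alternating

namespace Literature.Geometry.Kaehler.ComplexTorus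

universe uE

/-! ## §1 The arithmetic of a type and its dual type: `k!·(d₁⋯d_g)·Ĉ_l = l!·C_k·(d₁d_g)^l` -/

section Arithmetic

variable {ι : Type*} {E : Type uE} [NormedAddCommGroup E] [NormedSpace ℂ E] {Φ : (ι → ℝ) ≃L[ℝ] E} {j k l : ℕ}
  {η : E [⋀^Fin 2]→L[ℝ] ℝ} {d : Fin (j + 2) → ℕ}

/-- `(−1)^m·(−1)^m = 1`. [folklore] -/
private theorem neg_one_pow_mul_self₁₀₄ (m : ℕ) : ((-1 : ℂ) ^ m) * (-1) ^ m = 1 := by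
  rw [← pow_add, ← two_mul, pow_mul, neg_one_sq, one_pow]

/-- The last `l` entries of a type, read backwards or forwards, have the same product: `∏_{i<l} d_{g−1−i} = ∏_{i<l} d_{k+i}` (`k + l = g`).
[cite: Lange2023AbelianVarietiesComplex, §1.5.1 (PDF p. 51)] -/
theorem IsPolarizationType.prod_rev_castLE_eq_prod_natAdd (hl : l ≤ j + 2) (hkl : k + l = j + 2) (f : Fin (j + 2) → ℕ) :
    ∏ i : Fin l, f (Fin.rev (Fin.castLE hl i)) = ∏ i : Fin l, f (Fin.castLE hkl.le (Fin.natAdd k i)) := by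
  have hidx : ∀ i : Fin l, Fin.rev (Fin.castLE hl i) = Fin.castLE hkl.le (Fin.natAdd k (Fin.rev i)) := fun i ↦ by
    apply Fin.ext
    rw [Fin.val_rev, Fin.val_castLE, Fin.val_castLE, Fin.val_natAdd, Fin.val_rev]
    omega
  simp_rw [hidx]
  exact Fintype.prod_equiv Fin.revPerm _ _ fun i ↦ rfl

/-- **`(∏_{i<l} δ̂ᵢ)·(d_{k+1}⋯d_g) = (d₁d_g)^l`** for the dual type `δ̂ᵢ = d₁d_g/d_{g+1−i}` (`k + l = g`; each division is exact, `dᵢ ∣ d_g ∣ d₁d_g`).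
[cite: Lange2023AbelianVarietiesComplex, §2.5.1 Prop. 2.5.1 (p. 131); §1.5.1 (PDF p. 51)] -/
theorem IsPolarizationType.prod_dualType_castLE_mul_prod_eq_pow (hd : IsPolarizationType Φ η d) (hl : l ≤ j + 2) (hkl : k + l = j + 2) :
    (∏ i : Fin l, d 0 * d (Fin.last (j + 1)) / d (Fin.rev (Fin.castLE hl i))) * ∏ i : Fin l, d (Fin.castLE hkl.le (Fin.natAdd k i)) =
      (d 0 * d (Fin.last (j + 1))) ^ l := by
  rw [← IsPolarizationType.prod_rev_castLE_eq_prod_natAdd hl hkl d, ← Finset.prod_mul_distrib]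
  have hterm : ∀ i : Fin l, d 0 * d (Fin.last (j + 1)) / d (Fin.rev (Fin.castLE hl i)) * d (Fin.rev (Fin.castLE hl i)) =
      d 0 * d (Fin.last (j + 1)) := fun i ↦
    Nat.div_mul_cancel ((hd.dvd (Fin.le_last _)).mul_left _)
  simp_rw [hterm]
  rw [Finset.prod_const, Finset.card_univ, Fintype.card_fin]

/-- **THE ARITHMETIC OF A TYPE AND ITS DUAL TYPE: `k!·(d₁⋯d_g)·Ĉ_l = l!·C_k·(d₁d_g)^l`** for `k + l = g`, where `C_k = k!·d₁⋯d_k` is the content of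
`θ^{∧k}` (Thm. 2.5.16) and `Ĉ_l = l!·δ̂₁⋯δ̂_l`, `δ̂ᵢ = d₁d_g/d_{g+1−i}`, the content of `θ̂^{∧l}` for the dual polarisation of type `δ̂` (Prop. 2.5.1):
`d₁⋯d_g = (d₁⋯d_k)·(d_{k+1}⋯d_g)` and `(δ̂₁⋯δ̂_l)·(d_{k+1}⋯d_g) = (d₁d_g)^l`.
[cite: Lange2023AbelianVarietiesComplex, §2.5.1 Prop. 2.5.1 (p. 131); §2.5.3 Thm. 2.5.16 (PDF p. 135); §1.5.1 (PDF p. 51)] -/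
theorem IsPolarizationType.factorial_mul_prod_mul_dualContent_eq (hd : IsPolarizationType Φ η d) (hk : k ≤ j + 2) (hl : l ≤ j + 2)
    (hkl : k + l = j + 2) :
    k.factorial * (∏ i, d i) * (l.factorial * ∏ i : Fin l, d 0 * d (Fin.last (j + 1)) / d (Fin.rev (Fin.castLE hl i))) =
      l.factorial * (k.factorial * ∏ i : Fin k, d (Fin.castLE hk i)) * (d 0 * d (Fin.last (j + 1))) ^ l := by
  -- `d₁⋯d_g = (d₁⋯d_k)·(d_{k+1}⋯d_g)`
  have hsplit : ∏ i, d i = (∏ i : Fin k, d (Fin.castLE hk i)) * ∏ i : Fin l, d (Fin.castLE hkl.le (Fin.natAdd k i)) := by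
    have h1 : ∏ i, d i = ∏ i : Fin (k + l), d (Fin.castLE hkl.le i) := by
      rw [← Fintype.prod_equiv (finCongr hkl) (fun i : Fin (k + l) ↦ d (Fin.castLE hkl.le i)) d fun i ↦ rfl]
    rw [h1, Fin.prod_univ_add]
    rfl
  rw [hsplit, ← hd.prod_dualType_castLE_mul_prod_eq_pow hl hkl]
  ring

end Arithmetic

/-! ## §2 `F(γ_k) = (−1)^k·γ̂_l` -/

section MinimalClass

variable {ι : Type*} [Fintype ι] [LinearOrder ι] {E : Type uE} [NormedAddCommGroup E] [NormedSpace ℂ E]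
  (Φ : (ι → ℝ) ≃L[ℝ] E) {j n k l : ℕ} {η : E [⋀^Fin 2]→L[ℝ] ℝ} {d : Fin (j + 2) → ℕ}

/-- `E_δ^{∧l} = (d₁d_g)^l·(E^*)^{∧l}` for the dual polarisation `E_δ = d₁d_g·E^*`. [cite: Lange2023AbelianVarietiesComplex, §2.5.1 Prop. 2.5.1 (p. 131)] -/
private theorem wedgePow_ofRealForm_dualPolarization₁₀₄ (hη : IsRiemannForm Φ η) (d : Fin (j + 2) → ℕ) (l : ℕ) :
    wedgePow (ofRealForm (((d 0 * d (Fin.last (j + 1)) : ℕ) : ℝ) • dualForm Φ hη.1 hη.nondegenerate)) l =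
      ((d 0 * d (Fin.last (j + 1)) : ℕ) : ℂ) ^ l • wedgePow (ofRealForm (dualForm Φ hη.1 hη.nondegenerate)) l := by
  rw [ofRealForm_smul, wedgePow_smul, Complex.ofReal_natCast]

/-- **THE FOURIER TRANSFORM EXCHANGES THE MINIMAL CLASSES: `F(γ_k) = (−1)^k·γ̂_l`** (`k + l = g`). If `θ^{∧k} = (k!·d₁⋯d_k)·γ_k` (the minimal class
of codimension `k` of `(X, E)`, Thm. 2.5.16) and `θ̂^{∧l} = (l!·δ̂₁⋯δ̂_l)·γ̂_l` for `θ̂ = E_δ = d₁d_g·E^*` the dual polarisation of `X̂`, of type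
`δ̂ᵢ = d₁d_g/d_{g+1−i}` (Prop. 2.5.1), then `F(γ_k) = (−1)^k·γ̂_l`: Beauville's `l!·F(θ^{∧k}) = (−1)^k·k!·(d₁⋯d_g)·(E^*)^{∧l}` (Thm. 6.3.5 / (6.12))
and the arithmetic identity `k!·(d₁⋯d_g)·Ĉ_l = l!·C_k·(d₁d_g)^l` of §1. Principal case: `F(θ^{∧k}/k!) = (−1)^k·θ̂^{∧l}/l!`; on a Jacobian
`γ_k = {W_{g−k}}` (Poincaré's formula).
[cite: Lange2023AbelianVarietiesComplex, §6.3.2 Thm. 6.3.5 with (6.12) (pp. 315–316); §2.5.3 Thm. 2.5.16 (PDF p. 135); §2.5.1 Prop. 2.5.1 (p. 131); §4.2 (PDF p. 204)] [cite: Beauville1983FourierChow, §3 Prop. 5 (p. 248)] [cite: Mukai1981, §2 Thm. 2.2] -/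
theorem IsPolarizationType.fourierForm_minimalClass (hd : IsPolarizationType Φ η d) (hη : IsRiemannForm Φ η) (hk : k ≤ j + 2) (hl : l ≤ j + 2)
    (hkl : k + l = j + 2) (e : Fin n ≃ ι) (hn : 2 * k + 2 * l = n) {γ : E [⋀^Fin (2 * k)]→L[ℝ] ℂ}
    (hγ : wedgePow (ofRealForm η) k = ((k.factorial * ∏ i : Fin k, d (Fin.castLE hk i) : ℕ) : ℂ) • γ)
    {γ' : (E →L⋆[ℂ] ℂ) [⋀^Fin (2 * l)]→L[ℝ] ℂ}
    (hγ' : wedgePow (ofRealForm (((d 0 * d (Fin.last (j + 1)) : ℕ) : ℝ) • dualForm Φ hη.1 hη.nondegenerate)) l =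
      ((l.factorial * ∏ i : Fin l, d 0 * d (Fin.last (j + 1)) / d (Fin.rev (Fin.castLE hl i)) : ℕ) : ℂ) • γ') :
    fourierForm Φ e hn γ = ((-1 : ℂ) ^ k) • γ' := by
  -- `l!·C_k·F(γ_k) = (−1)^k·k!·d·(E^*)^{∧l}`
  have hB := hd.factorial_smul_fourierForm_wedgePow Φ hη (show l + k = j + 2 by omega) e hn
  rw [hγ, fourierForm_smul, smul_smul] at hB
  -- `Ĉ_l·γ̂_l = θ̂^{∧l} = (d₁d_g)^l·(E^*)^{∧l}`
  have hD := wedgePow_ofRealForm_dualPolarization₁₀₄ Φ hη d l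
  rw [hγ'] at hD
  set D : ℂ := ((d 0 * d (Fin.last (j + 1)) : ℕ) : ℂ) with hDdef
  set C : ℂ := ((k.factorial * ∏ i : Fin k, d (Fin.castLE hk i) : ℕ) : ℂ) with hCdef
  set Cd : ℂ := ((l.factorial * ∏ i : Fin l, d 0 * d (Fin.last (j + 1)) / d (Fin.rev (Fin.castLE hl i)) : ℕ) : ℂ) with hCddef
  set c : ℂ := (-1 : ℂ) ^ k * k.factorial * ∏ i, (d i : ℂ) with hcdef
  have h2 : (D ^ l * ((l.factorial : ℂ) * C)) • fourierForm Φ e hn γ = (c * Cd) • γ' :=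
    calc (D ^ l * ((l.factorial : ℂ) * C)) • fourierForm Φ e hn γ
        = D ^ l • (((l.factorial : ℂ) * C) • fourierForm Φ e hn γ) := by rw [smul_smul]
      _ = D ^ l • (c • wedgePow (ofRealForm (dualForm Φ hη.1 hη.nondegenerate)) l) := by rw [hB]
      _ = c • (D ^ l • wedgePow (ofRealForm (dualForm Φ hη.1 hη.nondegenerate)) l) := smul_comm _ _ _
      _ = c • (Cd • γ') := congrArg (fun w ↦ c • w) hD.symm
      _ = (c * Cd) • γ' := smul_smul _ _ _
  -- the arithmetic identity turns the right-hand coefficient into `(−1)^k` times the left-hand one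
  have harith := hd.factorial_mul_prod_mul_dualContent_eq hk hl hkl
  have hc : c * Cd = D ^ l * ((l.factorial : ℂ) * C) * (-1) ^ k := by
    have h := congrArg (fun m : ℕ ↦ ((m : ℂ)) * (-1) ^ k) harith
    simp only [hcdef, hCddef, hDdef, hCdef]
    push_cast at h ⊢
    linear_combination h
  rw [hc] at h2
  conv at h2 => rhs; rw [mul_smul]
  have hne : D ^ l * ((l.factorial : ℂ) * C) ≠ 0 := by
    refine mul_ne_zero (pow_ne_zero _ ?_) (mul_ne_zero ?_ ?_)
    · rw [hDdef]
      exact_mod_cast (Nat.mul_pos (hd.pos hη _) (hd.pos hη _)).ne'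
    · exact_mod_cast (Nat.factorial_pos _).ne'
    · rw [hCdef]
      exact_mod_cast (Nat.mul_pos (Nat.factorial_pos _) (Finset.prod_pos fun i _ ↦ hd.pos hη _)).ne'
  exact smul_right_injective _ hne h2

/-- **Data-free form: the minimal classes `γ_k ∈ Hdgᵏ(X, ℤ)` and `γ̂_l ∈ Hdg^l(X̂, ℤ)` exist and `F(γ_k) = (−1)^k·γ̂_l`** (`k + l = g`; the minimal
classes of `(X, E)` of type `(d₁, …, d_g)` and of `(X̂, E_δ)` of type `(d₁d_g/d_g, …, d₁d_g/d₁)`, Thm. 2.5.16 on both tori).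
[cite: Lange2023AbelianVarietiesComplex, §6.3.2 Thm. 6.3.5 (p. 315); §2.5.3 Thm. 2.5.16 (PDF p. 135); §2.5.1 Prop. 2.5.1 (p. 131)] [cite: Beauville1983FourierChow, §3 Prop. 5 (p. 248)] [cite: BenoistDebarre2023SmoothSubvarietiesJacobians, §1 (p. 3)] -/
theorem IsPolarizationType.exists_fourierForm_minimalClass (hd : IsPolarizationType Φ η d) (hη : IsRiemannForm Φ η) (hk : k ≤ j + 2)
    (hl : l ≤ j + 2) (hkl : k + l = j + 2) (e : Fin n ≃ ι) (hn : 2 * k + 2 * l = n) :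
    ∃ γ ∈ integralHodgeClassesIn Φ (2 * k) k, ∃ γ' ∈ integralHodgeClassesIn (dualPeriod Φ) (2 * l) l,
      wedgePow (ofRealForm η) k = ((k.factorial * ∏ i : Fin k, d (Fin.castLE hk i) : ℕ) : ℂ) • γ ∧
      wedgePow (ofRealForm (((d 0 * d (Fin.last (j + 1)) : ℕ) : ℝ) • dualForm Φ hη.1 hη.nondegenerate)) l =
        ((l.factorial * ∏ i : Fin l, d 0 * d (Fin.last (j + 1)) / d (Fin.rev (Fin.castLE hl i)) : ℕ) : ℂ) • γ' ∧
      fourierForm Φ e hn γ = ((-1 : ℂ) ^ k) • γ' := by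
  obtain ⟨γ, hγZ, hγ⟩ := hd.exists_mem_integralForms_wedgePow_eq_content_smul hk
  have hd' := hd.dual Φ hη
  have hη' := hη.dualPolarization Φ hd
  obtain ⟨γ', hγ'Z, hγ'⟩ := hd'.exists_mem_integralForms_wedgePow_eq_content_smul hl
  exact ⟨γ, hd.mem_integralHodgeClasses_of_wedgePow_eq_content_smul hη hk hγZ hγ, γ',
    hd'.mem_integralHodgeClasses_of_wedgePow_eq_content_smul hη' hl hγ'Z hγ', hγ, hγ',
    hd.fourierForm_minimalClass Φ hη hk hl hkl e hn hγ hγ'⟩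

end MinimalClass

/-! ## §3 `⟨γ̂_l, F z⟩^X̂ = (−1)^l·⟨γ_k, z⟩^X`: the value group of a minimal class is Fourier-invariant -/

section ValueGroup

variable {ι : Type*} [Fintype ι] [LinearOrder ι] {E : Type uE} [NormedAddCommGroup E] [NormedSpace ℂ E]
  (Φ : (ι → ℝ) ≃L[ℝ] E) {j n k l : ℕ} {η : E [⋀^Fin 2]→L[ℝ] ℝ} {d : Fin (j + 2) → ℕ}

/-- **`⟨γ̂_l, F z⟩^X̂_e = (−1)^l·⟨γ_k, z⟩^X_e`** for every `z ∈ H^{2l}(X, ℂ)` (`k + l = g`): Parseval `⟨F γ_k, F z⟩^X̂ = (−1)^g⟨γ_k, z⟩^X` (Prop. 6.2.20)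
and `F(γ_k) = (−1)^k γ̂_l` (§2). The pairing of a class with the minimal class `γ_k` is, up to sign, the pairing of its Fourier transform with
the dual minimal class `γ̂_l`.
[cite: Lange2023AbelianVarietiesComplex, §6.2.4 Prop. 6.2.20 (pp. 310–311); §6.3.2 Thm. 6.3.5 (p. 315); §2.5.1 Prop. 2.5.1 (p. 131)] [cite: Beauville1983FourierChow, §3 Prop. 5 (p. 248)] [cite: Mukai1981, §2 Thm. 2.2] -/
theorem IsPolarizationType.poincarePairing_dualMinimalClass_fourierForm (hd : IsPolarizationType Φ η d) (hη : IsRiemannForm Φ η)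
    (hk : k ≤ j + 2) (hl : l ≤ j + 2) (hkl : k + l = j + 2) (e : Fin n ≃ ι) (hn : 2 * k + 2 * l = n) (hn' : 2 * l + 2 * k = n)
    {γ : E [⋀^Fin (2 * k)]→L[ℝ] ℂ} (hγ : wedgePow (ofRealForm η) k = ((k.factorial * ∏ i : Fin k, d (Fin.castLE hk i) : ℕ) : ℂ) • γ)
    {γ' : (E →L⋆[ℂ] ℂ) [⋀^Fin (2 * l)]→L[ℝ] ℂ}
    (hγ' : wedgePow (ofRealForm (((d 0 * d (Fin.last (j + 1)) : ℕ) : ℝ) • dualForm Φ hη.1 hη.nondegenerate)) l =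
      ((l.factorial * ∏ i : Fin l, d 0 * d (Fin.last (j + 1)) / d (Fin.rev (Fin.castLE hl i)) : ℕ) : ℂ) • γ')
    (z : E [⋀^Fin (2 * l)]→L[ℝ] ℂ) :
    poincarePairing (dualPeriod Φ) e hn' γ' (fourierForm Φ e hn' z) = (-1) ^ l * poincarePairing Φ e hn γ z := by
  have hP := poincarePairing_fourierForm_fourierForm_of_add Φ e hn hn' γ z
  rw [hd.fourierForm_minimalClass Φ hη hk hl hkl e hn hγ hγ', map_smul, LinearMap.smul_apply, smul_eq_mul] at hP
  have hfr : finrank ℂ E = l + k := finrank_eq_add_of_equiv Φ ((finCongr hn).trans e)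
  have hsign : (-1 : ℂ) ^ (finrank ℂ E + 2 * k * (2 * l)) = (-1) ^ l * (-1) ^ k := by
    rw [hfr, pow_add, pow_add, show 2 * k * (2 * l) = 2 * (2 * k * l) by ring, pow_mul, neg_one_sq, one_pow, mul_one]
  rw [hsign] at hP
  linear_combination (-1 : ℂ) ^ k * hP -
    (poincarePairing (dualPeriod Φ) e hn' γ' (fourierForm Φ e hn' z) - (-1) ^ l * poincarePairing Φ e hn γ z) * neg_one_pow_mul_self₁₀₄ k

/-- **`⟨γ_k, z⟩^X = 0 ⟺ ⟨γ̂_l, F z⟩^X̂ = 0`**: the Fourier transform maps the `γ_k`-orthogonal classes of `H^{2l}(X)` onto the `γ̂_l`-orthogonal classes of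
`H^{2k}(X̂)`. [cite: Lange2023AbelianVarietiesComplex, §6.2.4 Prop. 6.2.20 (pp. 310–311); §6.3.2 Thm. 6.3.5 (p. 315)] -/
theorem IsPolarizationType.poincarePairing_minimalClass_eq_zero_iff_fourier (hd : IsPolarizationType Φ η d) (hη : IsRiemannForm Φ η)
    (hk : k ≤ j + 2) (hl : l ≤ j + 2) (hkl : k + l = j + 2) (e : Fin n ≃ ι) (hn : 2 * k + 2 * l = n) (hn' : 2 * l + 2 * k = n)
    {γ : E [⋀^Fin (2 * k)]→L[ℝ] ℂ} (hγ : wedgePow (ofRealForm η) k = ((k.factorial * ∏ i : Fin k, d (Fin.castLE hk i) : ℕ) : ℂ) • γ)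
    {γ' : (E →L⋆[ℂ] ℂ) [⋀^Fin (2 * l)]→L[ℝ] ℂ}
    (hγ' : wedgePow (ofRealForm (((d 0 * d (Fin.last (j + 1)) : ℕ) : ℝ) • dualForm Φ hη.1 hη.nondegenerate)) l =
      ((l.factorial * ∏ i : Fin l, d 0 * d (Fin.last (j + 1)) / d (Fin.rev (Fin.castLE hl i)) : ℕ) : ℂ) • γ')
    (z : E [⋀^Fin (2 * l)]→L[ℝ] ℂ) :
    poincarePairing Φ e hn γ z = 0 ↔ poincarePairing (dualPeriod Φ) e hn' γ' (fourierForm Φ e hn' z) = 0 := by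
  rw [hd.poincarePairing_dualMinimalClass_fourierForm Φ hη hk hl hkl e hn hn' hγ hγ' z, mul_eq_zero,
    or_iff_right (pow_ne_zero _ (neg_ne_zero.2 one_ne_zero))]

/-- **THE VALUE GROUP OF A MINIMAL CLASS IS FOURIER-INVARIANT**: if `ε` divides every `⟨γ_k, z⟩`, `z ∈ Hdg^l(X, ℤ)`, and is such a value, then `ε`
divides every `⟨γ̂_l, w⟩`, `w ∈ Hdgᵏ(X̂, ℤ)`, and is such a value (`F : Hdg^l(X, ℤ) ⥲ Hdgᵏ(X̂, ℤ)`, Prop. 6.2.20/6.2.21, with §3's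
`⟨γ̂_l, F z⟩ = ±⟨γ_k, z⟩`): `⟨γ_k, Hdg^l(X, ℤ)⟩ = ⟨γ̂_l, Hdgᵏ(X̂, ℤ)⟩` as subgroups of `ℤ`.
[cite: Lange2023AbelianVarietiesComplex, §6.2.4 Prop. 6.2.20, Prop. 6.2.21 (pp. 310–311); §6.3.2 Thm. 6.3.5 (p. 315); §2.5.1 Prop. 2.5.1 (p. 131)] [cite: Beauville1983FourierChow, §3 Prop. 5 (p. 248)] -/
theorem IsPolarizationType.minimalClass_valueGenerator_dual (hd : IsPolarizationType Φ η d) (hη : IsRiemannForm Φ η)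
    (hk : k ≤ j + 2) (hl : l ≤ j + 2) (hkl : k + l = j + 2) (e : Fin n ≃ ι) (hn : 2 * k + 2 * l = n) (hn' : 2 * l + 2 * k = n)
    {γ : E [⋀^Fin (2 * k)]→L[ℝ] ℂ} (hγ : wedgePow (ofRealForm η) k = ((k.factorial * ∏ i : Fin k, d (Fin.castLE hk i) : ℕ) : ℂ) • γ)
    {γ' : (E →L⋆[ℂ] ℂ) [⋀^Fin (2 * l)]→L[ℝ] ℂ}
    (hγ' : wedgePow (ofRealForm (((d 0 * d (Fin.last (j + 1)) : ℕ) : ℝ) • dualForm Φ hη.1 hη.nondegenerate)) l =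
      ((l.factorial * ∏ i : Fin l, d 0 * d (Fin.last (j + 1)) / d (Fin.rev (Fin.castLE hl i)) : ℕ) : ℂ) • γ')
    {ε : ℕ}
    (hε : (∀ z ∈ integralHodgeClassesIn Φ (2 * l) l, ∃ c : ℤ, poincarePairing Φ e hn γ z = c ∧ (ε : ℤ) ∣ c) ∧
      ∃ z ∈ integralHodgeClassesIn Φ (2 * l) l, poincarePairing Φ e hn γ z = (ε : ℂ)) :
    (∀ w ∈ integralHodgeClassesIn (dualPeriod Φ) (2 * k) k, ∃ c : ℤ, poincarePairing (dualPeriod Φ) e hn' γ' w = c ∧ (ε : ℤ) ∣ c) ∧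
      ∃ w ∈ integralHodgeClassesIn (dualPeriod Φ) (2 * k) k, poincarePairing (dualPeriod Φ) e hn' γ' w = (ε : ℂ) := by
  have key := hd.poincarePairing_dualMinimalClass_fourierForm Φ hη hk hl hkl e hn hn' hγ hγ'
  refine ⟨fun w hw ↦ ?_, ?_⟩
  · -- `w = F z₀` with `z₀ ∈ Hdg^l(X, ℤ)`
    obtain ⟨z₀, hz₀, hFz₀⟩ := exists_mem_integralHodgeClasses_fourierForm_eq Φ ((finCongr hn').trans e)
      (show w ∈ integralHodgeClasses (dualPeriod Φ) k from hw)
    rw [← fourierForm_eq_fourierForm_of_eq Φ e ((finCongr hn').trans e) hn' rfl] at hFz₀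
    obtain ⟨c₀, hc₀, hεc₀⟩ := hε.1 z₀ hz₀
    refine ⟨(-1) ^ l * c₀, ?_, (hεc₀.mul_left _)⟩
    rw [← hFz₀, key z₀, hc₀, Int.cast_mul, Int.cast_pow, Int.cast_neg, Int.cast_one]
  · obtain ⟨z₁, hz₁, hz₁ε⟩ := hε.2
    have hF : ∀ z ∈ integralHodgeClassesIn Φ (2 * l) l, fourierForm Φ e hn' z ∈ integralHodgeClassesIn (dualPeriod Φ) (2 * k) k :=
      fun z hz ↦ by
        rw [fourierForm_eq_fourierForm_of_eq Φ e ((finCongr hn').trans e) hn' rfl]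
        exact fourierForm_mem_integralHodgeClasses Φ ((finCongr hn').trans e) hz
    rcases neg_one_pow_eq_or ℂ l with h1 | h1
    · exact ⟨fourierForm Φ e hn' z₁, hF z₁ hz₁, by rw [key z₁, hz₁ε, h1, one_mul]⟩
    · refine ⟨fourierForm Φ e hn' (-z₁), hF (-z₁) (neg_mem hz₁), ?_⟩
      rw [key (-z₁), map_neg, hz₁ε, h1]
      ring

/-- **`⟨γ_k, Hdg^l(X, ℤ)⟩ = ⟨γ̂_l, Hdgᵏ(X̂, ℤ)⟩`, both ways**: a positive `ε` generates the value group of the minimal class `γ_k` on the integral Hodge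
lattice `Hdg^l(X, ℤ)` iff it generates the value group of the dual minimal class `γ̂_l` on `Hdgᵏ(X̂, ℤ)` (the converse direction runs §3 again
with the inverse correspondence `w ↦ z`, `F z = w`). With g49-#11 (`δ_l(X) = C_k·ε`, `δ̂_k(X̂) = Ĉ_l·ε`) this is g50-#1's
`δ_l(X)·l!·(d₁d_g)^l = δ̂_k(X̂)·k!·d₁⋯d_g`, read through §1.
[cite: Lange2023AbelianVarietiesComplex, §6.2.4 Prop. 6.2.20, Prop. 6.2.21 (pp. 310–311); §6.3.2 Thm. 6.3.5 (p. 315); §2.5.1 Prop. 2.5.1 (p. 131); §6.2.4 (PDF p. 310 L9–L13)] [cite: Beauville1983FourierChow, §3 Prop. 5 (p. 248)] -/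
theorem IsPolarizationType.minimalClass_valueGenerator_iff_dual (hd : IsPolarizationType Φ η d) (hη : IsRiemannForm Φ η)
    (hk : k ≤ j + 2) (hl : l ≤ j + 2) (hkl : k + l = j + 2) (e : Fin n ≃ ι) (hn : 2 * k + 2 * l = n) (hn' : 2 * l + 2 * k = n)
    {γ : E [⋀^Fin (2 * k)]→L[ℝ] ℂ} (hγ : wedgePow (ofRealForm η) k = ((k.factorial * ∏ i : Fin k, d (Fin.castLE hk i) : ℕ) : ℂ) • γ)
    {γ' : (E →L⋆[ℂ] ℂ) [⋀^Fin (2 * l)]→L[ℝ] ℂ}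
    (hγ' : wedgePow (ofRealForm (((d 0 * d (Fin.last (j + 1)) : ℕ) : ℝ) • dualForm Φ hη.1 hη.nondegenerate)) l =
      ((l.factorial * ∏ i : Fin l, d 0 * d (Fin.last (j + 1)) / d (Fin.rev (Fin.castLE hl i)) : ℕ) : ℂ) • γ')
    (ε : ℕ) :
    ((∀ z ∈ integralHodgeClassesIn Φ (2 * l) l, ∃ c : ℤ, poincarePairing Φ e hn γ z = c ∧ (ε : ℤ) ∣ c) ∧
        ∃ z ∈ integralHodgeClassesIn Φ (2 * l) l, poincarePairing Φ e hn γ z = (ε : ℂ)) ↔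
      ((∀ w ∈ integralHodgeClassesIn (dualPeriod Φ) (2 * k) k, ∃ c : ℤ, poincarePairing (dualPeriod Φ) e hn' γ' w = c ∧ (ε : ℤ) ∣ c) ∧
        ∃ w ∈ integralHodgeClassesIn (dualPeriod Φ) (2 * k) k, poincarePairing (dualPeriod Φ) e hn' γ' w = (ε : ℂ)) := by
  refine ⟨hd.minimalClass_valueGenerator_dual Φ hη hk hl hkl e hn hn' hγ hγ', fun hε' ↦ ?_⟩
  have key := hd.poincarePairing_dualMinimalClass_fourierForm Φ hη hk hl hkl e hn hn' hγ hγ'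
  have hF : ∀ z ∈ integralHodgeClassesIn Φ (2 * l) l, fourierForm Φ e hn' z ∈ integralHodgeClassesIn (dualPeriod Φ) (2 * k) k :=
    fun z hz ↦ by
      rw [fourierForm_eq_fourierForm_of_eq Φ e ((finCongr hn').trans e) hn' rfl]
      exact fourierForm_mem_integralHodgeClasses Φ ((finCongr hn').trans e) hz
  refine ⟨fun z hz ↦ ?_, ?_⟩
  · obtain ⟨c, hc, hεc⟩ := hε'.1 _ (hF z hz)
    refine ⟨(-1) ^ l * c, ?_, hεc.mul_left _⟩
    have h := key z
    rw [hc] at h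
    rw [Int.cast_mul, Int.cast_pow, Int.cast_neg, Int.cast_one]
    linear_combination (-(-1 : ℂ) ^ l) * h - poincarePairing Φ e hn γ z * neg_one_pow_mul_self₁₀₄ l
  · obtain ⟨w₁, hw₁, hw₁ε⟩ := hε'.2
    obtain ⟨z₁, hz₁, hFz₁⟩ := exists_mem_integralHodgeClasses_fourierForm_eq Φ ((finCongr hn').trans e)
      (show w₁ ∈ integralHodgeClasses (dualPeriod Φ) k from hw₁)
    rw [← fourierForm_eq_fourierForm_of_eq Φ e ((finCongr hn').trans e) hn' rfl] at hFz₁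
    have h := key z₁
    rw [hFz₁, hw₁ε] at h
    rcases neg_one_pow_eq_or ℂ l with h1 | h1
    · exact ⟨z₁, hz₁, by rw [h1, one_mul] at h; exact h.symm⟩
    · refine ⟨-z₁, neg_mem hz₁, ?_⟩
      rw [map_neg, show poincarePairing Φ e hn γ z₁ = -(ε : ℂ) by rw [h1] at h; linear_combination h, neg_neg]

end ValueGroup

end Literature.Geometry.Kaehler.ComplexTorus

end
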